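import Literature.MathematicalPhysics.QuantumFieldTheory.Balaban1983to89.B9Thm311PosDefQknitOfRegYP335AtLettersY

/-!
# `Balaban1983to89.B9Thm311FormGapOfLawsAtLettersY` — T. Bałaban, *Propagators for lattice gauge theories in a background field*, Commun. Math. Phys. **99**
# (1985) 389–434 [Balaban1985BackgroundPropagators], THEOREM 3.11 WITH A CONSTANT, RE-PRESSED ONCE AT A PARAMETRIC SITE TRANSPORTER `(parS, Gp)` WITH
# THEOREM 3.3's BLOCK, THE SYMMETRY OF `Δ_a` AND THE POSITIVITY OF `R` DISPLAYED AS LAWS (director-ym №383 «GO CASCADE-K», K2)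

statement-level skeleton of published theorems with citation tags; proofs where landed; nothing here is a claim about the Yang–Mills mass gap

THE PRINT.  Thm 3.11 p. 416; Thm 3.3 p. 399 ((3.42) for `G = Δ_a⁻¹`); (3.25)–(3.27) pp. 394–395; (3.41) p. 397; (3.69) p. 404; [4] = *Propagators … II*, CMP **96**
(1984), Lemma 2.1 (2.60)–(2.61) p. 234, (2.51)–(2.52) p. 232.

WHY THIS FILE (cell `pub-ymgap`, node N06, seat `dag-n06-j` = bundle F5, gen 35).  `B9Thm311FormGapOfRegYP335AtLettersY` (✓) proves the scale-weighted form gap of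
`Δ_a(U)` at def-Y's letters of record `(parSymY, parBY, GpY parSymY)`, resting on cell `lit-balaban`'s Theorem 3.3 block and on `deltaAY_parSymY_isSymmTr`,
`trIP_RY_parSymY_self_nonneg` — all pinned to `parSymY`.  CASCADE-K moves the certificate's averaging site transporter to the knit table `parKnitY`; by the K2
rule («re-press once over `(parS, Gp)`, parSymY-specific facts displayed as laws») THIS FILE re-presses the gap at an ARBITRARY `(parS, Gp)` with four laws
displayed at the configuration: Thm 3.3's block (`IsUnit Δ_a(U)` and `EBlock` of `G = Δ_a⁻¹` with constants `K_A, δ_A`), `Δ_a(U)` symmetric, and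
`⟨f, R(U)f⟩ ≥ 0`; the (3.69) plaquette window comes from the class (parS-free).  At `(parSymY, GpY parSymY)` the laws are the gen-31 theorems; at `parKnitY`
Thm 3.3's block is the open K2 law (locator Thm 3.3 p. 399), the others are dag-n06-l's knit-letter facts.

WHAT IS PROVED (sorry-free; 0 `def`).  ★★★ `formGap_deltaAY_of_laws (hN) (hδA : 0 < δA) (hKA : 0 ≤ KA) : ∃ M₁ a₁ γ > 0, ∀ x, Surjective β → M₁ ≤ M →
∀ α₀ > 0, Mα₀ ≤ a₁ → ∀ U ∈ (bg9YP … x).Reg335 c₃₅ α₀, ∀ parS Gp, IsUnit (Δ_a) → EBlock (… GAY parS parBY Gp …) KA δA U → IsSymmTr 1 (Δ_a) →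
(∀ f, 0 ≤ ⟨f, R f⟩₁) → ∀ A, γ·Σ_b c_f²(L^{lev b})⁻²‖A b‖²_HS ≤ ⟨A, Δ_a(U)A⟩₁` (`Δ_a = deltaAY x parS parBY Gp U`; `γ = R⁻¹` from `K_A, δ_A, L, d, N` only);
★★★ `posDefTr_deltaAQY_of_close_of_laws` — row 17 at `deltaAQY x 𝔮 𝔮s parS Gp` from the same laws + adjointness of the pair + ONE ℓ²-closeness to a
row-wise rebased `QY parBY U` + one numeric (the parametric twin of `…AveragingSwapClose.posDefTr_deltaAQY_of_close_of_regYP335_section`).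
HONEST SCOPE.  The gen-31∕35 assembly verbatim with three inputs turned into hypotheses; NOT a node discharge; count-neutral; nothing continuum ∕ OS ∕ mass gap ∕
Clay.  No `sorry`, no `axiom`, no `instance`, no `notation`, no `def`.
-/

noncomputable section

namespace Literature.MathematicalPhysics.QuantumFieldTheory.Balaban1983to89.B9Thm311FormGapOfLawsAtLettersY

open Literature.MathematicalPhysics.QuantumFieldTheory.Balaban1983to89
open B6RandomWalk B9Thm311ReadingCoords B9Thm39ReadingCoords B9Thm39ReadingAtLetters Node00
open B6KLevelCensusIndexV1 B6Ineq2142KLevelV1 B6GlobalChartV1 B9PinMembersKLevelV1 B9PinGeometryKLevelV1 B9GeoNormsKLevelV1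
  B9BackgroundsKLevelV1 B9BackgroundsKLevelV1P B9Thm34Ext
open B9Thm311PosDefViaSpectralGap B9Thm311HessianWeightedLowerBoundY B9Thm311EigenBoundOfMajorant B9Thm310DeltaAIsUnitOfRegYP335AtLettersY
open B9Thm311PosDefOfRegYP335AtLettersY B9Thm311FormGapOfRegYP335AtLettersY B9Thm311PosDefAveragingSwap B9Eq315QYSizeWeightedL2Y
  B9Thm311PosDefAveragingSwapClose B9Eq315QLetterL2SizeFromClosenessY
open Literature.MathematicalPhysics.QuantumFieldTheory.Balaban1983to89.B9Thm37Sum (mulOp mulOp_apply)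
open Literature.MathematicalPhysics.QuantumFieldTheory.Balaban1983to89.B9Thm37CubeCoverCommutators (cutMulY cutMulY_apply)
open Literature.MathematicalPhysics.QuantumFieldTheory.Balaban1983to89.B9Eq352DivFormLetters (conj conj_apply coordEquiv)
open Literature.MathematicalPhysics.QuantumFieldTheory.Balaban1983to89.B9CubeLettersInvReadDictBMajorants (hasMajorant_conj_G_of_eBlockInvB)
open Literature.MathematicalPhysics.QuantumFieldTheory.Balaban1983to89.B9GeoLemma21KLevelV1 (rowSum_geo9K_core transferL_geo9K geo9K_dist_comm geo9K_dist_nonneg' geo9K_len_pos geo9K_one_le_L)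
open Literature.MathematicalPhysics.QuantumFieldTheory.Balaban1983to89.B6Cor28 (TransferL)
open Literature.MathematicalPhysics.QuantumFieldTheory.Balaban1983to89.B6RandomWalk (HasMajorant hasMajorant_mono)
open Literature.MathematicalPhysics.QuantumFieldTheory.Balaban1983to89.B9Ineq369CurvatureSmallAtLettersY (hs_nonneg trIP_one_self_eq)
open Literature.MathematicalPhysics.QuantumFieldTheory.Balaban1983to89.B9Thm39OneCubeReadingAtLettersY (geo9Y_M_nonneg)
open Literature.MathematicalPhysics.QuantumFieldTheory.Balaban1983to89.B9SectBCodedClassR (bg9YC extraYPb)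
open Literature.MathematicalPhysics.QuantumFieldTheory.Balaban1983to89.B9FromB6 (EBlock)
open Literature.MathematicalPhysics.QuantumFieldTheory.Balaban1983to89.B9CubeLettersInvReadings (kernelFamilyBInv)
open Literature.MathematicalPhysics.QuantumFieldTheory.Balaban1983to89.B9SectionCarryingMembersV1 (SCMemberY)
open Literature.MathematicalPhysics.QuantumFieldTheory.Balaban1983to89.B9Thm311DeltaPrimePos (trIP_add_right trIP_self_nonneg trIP_self_pos)
open Literature.MathematicalPhysics.QuantumFieldTheory.Balaban1983to89.B9Ineq349SiteAdjoint (trIP_comm)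
open Literature.MathematicalPhysics.QuantumFieldTheory.Balaban1983to89.B9Thm311ProjectionR (trIP_aY_eq)
open Literature.MathematicalPhysics.QuantumFieldTheory.Balaban1983to89.B9Thm311AdjointPairs (isAdjTr_QY_QsY_parBY isAdjTr_gradY_divY)
open Literature.MathematicalPhysics.QuantumFieldTheory.Balaban1983to89.B9Thm311FlippedBondForms (trIP_self_eq_sum)
open B9Thm311PosDefQknitOfRegYP335AtLettersY B9Eq3115KnitLetterYRowCloseness
open Literature.MathematicalPhysics.QuantumFieldTheory.Balaban1983to89.B9Eq3115KnitLetterY (QknitY zSrc)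
open Literature.MathematicalPhysics.QuantumFieldTheory.Balaban1983to89.B9Eq3115KnitLetterYOnto (kCol kCol_nonneg)
open Literature.MathematicalPhysics.QuantumFieldTheory.Balaban1983to89.B9Eq316AveragingTransposeZd (alphaQ)
open Literature.MathematicalPhysics.QuantumFieldTheory.Balaban1983to89.B9C2FormBoxRegimeY (Kpl)
open scoped InnerProductSpace

/-! ## §1 ★★★ The scale-weighted gap of `Δ_a(U)` at a parametric `(parS, Gp)` from four displayed laws -/

section Record

open scoped Matrix.Norms.L2Operator
open B7Prop2SpecialUnitary

variable {N : ℕ} [Nonempty (Fin N)] (θ : Stage3Params) (Mstar : ℕ)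

omit [Nonempty (Fin N)] in
/-- ★★★ **THEOREM 3.11 WITH A GAP AT A PARAMETRIC SITE TRANSPORTER**, at every section-carrying member on print's class (3.35): for constants `δ_A > 0`,
`K_A ≥ 0` there are `M₁, a₁, γ > 0` such that for `β` onto, `M₁ ≦ M`, `0 < α₀`, `M·α₀ ≦ a₁`, `SU(N)`-valued `U ∈ (bg9YP … x).Reg335 c₃₅ α₀`, and every
`(parS, Gp)` satisfying AT `U` the four LAWS — `IsUnit Δ_a(U)`, the (3.42) block `EBlock` of `G = Δ_a⁻¹` with `(K_A, δ_A)`, `Δ_a(U)` symmetric, `R(U) ≥ 0` —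
`γ·Σ_b c_f²(L^{lev b})⁻²‖A(b)‖²_HS ≤ ⟨A, Δ_a(U)A⟩₁` for every `A` (`Δ_a = deltaAY x parS parBY Gp`).  ROAD = `formGap_deltaAY_of_regYP335_section` verbatim.
[cite: Balaban1985BackgroundPropagators, Thm 3.11 p.416; Thm 3.3 p.399; (3.26) p.395; (3.41) p.397; (3.69) p.404; Balaban1984PropagatorsII, Lemma 2.1 (2.60)–(2.61) p.234, (2.51)–(2.52) p.232] -/
theorem formGap_deltaAY_of_laws (hN : 1 ≤ N) {δA KA : ℝ} (hδA : 0 < δA) (hKA : 0 ≤ KA) :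
    ∃ M₁ a₁ γ : ℝ, 0 < M₁ ∧ 0 < a₁ ∧ 0 < γ ∧
    ∀ (x : MemberY θ.d₆ θ.ℓ₆ θ.hd' θ.hL' θ.b₀ θ.b₁ Mstar), Function.Surjective (β x.hN x.D x.hk) → M₁ ≤ (geo9Y x).M →
      ∀ α₀ : ℝ, 0 < α₀ → (geo9Y x).M * α₀ ≤ a₁ →
      ∀ U : CfgY (Matrix (Fin N) (Fin N) ℂ) x.toKIdx,
        (bg9YP (Matrix (Fin N) (Fin N) ℂ) (specialUnitaryUnits (Fin N)) x).Reg335 c35Y α₀ U →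
        ∀ (parS : SiteParY (Matrix (Fin N) (Fin N) ℂ) x.toKIdx) (Gp : SiteOpY (Matrix (Fin N) (Fin N) ℂ) x.toKIdx),
          IsUnit (deltaAY x.toKIdx parS (parBY x.toKIdx) Gp U) →
          EBlock (kernelFamilyBInv x.toKIdx (bg9YP (Matrix (Fin N) (Fin N) ℂ) (specialUnitaryUnits (Fin N)) x) (fun V => V)
            (GAY x.toKIdx parS (parBY x.toKIdx) Gp) (parBY x.toKIdx)) KA δA U →
          IsSymmTr (fun _ => (1 : ℝ)) (deltaAY x.toKIdx parS (parBY x.toKIdx) Gp U) →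
          (∀ f, 0 ≤ trIP (fun _ => (1 : ℝ)) f (RY x.toKIdx parS Gp U f)) →
        ∀ A : FBondY x.toKIdx → Matrix (Fin N) (Fin N) ℂ,
          γ * ∑ b, (x.toKIdx.cf ^ 2 * ((((θ.ℓ₆ : ℝ) + 1) ^ levV1 x.toKIdx b.src)⁻¹) ^ 2) * ∑ a, ∑ c, ‖A b a c‖ ^ 2
            ≤ trIP (fun _ => (1 : ℝ)) A (deltaAY x.toKIdx parS (parBY x.toKIdx) Gp U A) := by
  classical
  haveI : Nonempty (Fin N) := ⟨⟨0, hN⟩⟩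
  haveI instK : ∀ i' : KIdx θ.d₆ θ.ℓ₆ θ.hd' θ.hL' θ.b₀ θ.b₁, Fintype (geo9K i').Site := fun i' => (kGeoU i').fin
  -- [4] Lemma 2.1 (2.61): uniform row sums at rate `δ_A∕2`
  obtain ⟨ML, Crow, hrowC⟩ := rowSum_geo9K_core (d := θ.d₆) (ℓ := θ.ℓ₆) (hd := θ.hd') (hL := θ.hL') (b₀ := θ.b₀) (b₁ := θ.b₁)
    (κ := δA / 2) (half_pos hδA)
  -- constants
  set L : ℝ := (θ.ℓ₆ : ℝ) + 1 with hLdef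
  have hL1 : 1 ≤ L := by rw [hLdef]; have : (0 : ℝ) ≤ θ.ℓ₆ := Nat.cast_nonneg _; linarith
  have hL0 : 0 < L := lt_of_lt_of_le one_pos hL1
  have hMb : 0 ≤ coordBound39 (basis39 (Matrix (Fin N) (Fin N) ℂ)) := norm_nonneg _
  set C₀ : ℝ := coordBound39 (basis39 (Matrix (Fin N) (Fin N) ℂ)) * (∑ j, ‖basis39 (Matrix (Fin N) (Fin N) ℂ) j‖) * KA with hC₀
  have hC₀0 : 0 ≤ C₀ := mul_nonneg (mul_nonneg hMb (Finset.sum_nonneg fun _ _ => norm_nonneg _)) hKA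
  set R : ℝ := max (C₀ * L ^ |(1 : ℝ)| * Crow) 1 with hRdef
  have hR1 : 1 ≤ R := le_max_right _ _
  have hR0 : 0 < R := lt_of_lt_of_le one_pos hR1
  have he4 : 0 < Real.exp 4 := Real.exp_pos _
  set εc : ℝ := 12 * ((θ.d₆ : ℝ) + 1) * L ^ 2 * (40 * Real.exp 4 * L ^ 3) with hεc
  have hεc0 : 0 < εc := by positivity
  set Mtr : ℝ := |(1 : ℝ)| * Real.log L / (δA / 2 * (2 * L ^ 2 - 1)) with hMtr
  set abud : ℝ := min 1 (min (1 / (10 * L)) (min (1 / (40 * Real.exp 4 * L ^ 3)) (1 / (2 * εc * R)))) with habud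
  have habud0 : 0 < abud := by positivity
  refine ⟨max 1 (max ML (max Mtr 1)), abud, R⁻¹, lt_of_lt_of_le one_pos (le_max_left _ _), habud0, inv_pos.2 hR0, ?_⟩
  intro x hsurj hM α₀ hα ha U hU parS Gp hunit hEB hsymmA hRpsd A
  have hG : specialUnitaryUnits (Fin N) ≤ B7Prop2Explicit.unitaryUnits (Matrix (Fin N) (Fin N) ℂ) := specialUnitaryUnits_le_unitaryUnits
  have hUG : ∀ μ z, U μ z ∈ specialUnitaryUnits (Fin N) := hU.1.1
  have hU' : ∀ μ z, ((U μ z : (Matrix (Fin N) (Fin N) ℂ)ˣ) : Matrix (Fin N) (Fin N) ℂ) ∈ unitary (Matrix (Fin N) (Fin N) ℂ) :=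
    fun μ z => hG (hUG μ z)
  -- `Δ_a ≥ Δ` as forms from the laws: `⟨D*A, R D*A⟩ ≥ 0` and `⟨QA, aQA⟩ = ‖QA‖²_w ≥ 0`
  have hΔle : ∀ A' : FBondY x.toKIdx → Matrix (Fin N) (Fin N) ℂ,
      trIP (fun _ => (1 : ℝ)) A' (hessY x.toKIdx U A') ≤ trIP (fun _ => (1 : ℝ)) A' (deltaAY x.toKIdx parS (parBY x.toKIdx) Gp U A') := by
    intro A'
    rw [deltaAY, LinearMap.add_apply, LinearMap.add_apply, trIP_add_right, trIP_add_right, add_assoc]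
    refine le_add_of_nonneg_right (add_nonneg ?_ ?_)
    · rw [LinearMap.comp_apply, LinearMap.comp_apply, trIP_comm, isAdjTr_gradY_divY x.toKIdx U hU', trIP_comm]
      exact hRpsd _
    · rw [LinearMap.comp_apply, LinearMap.comp_apply, ← isAdjTr_QY_QsY_parBY x.toKIdx hG U hUG, trIP_aY_eq]
      exact trIP_self_nonneg _ x.toKIdx.hw _
  -- the member's letters
  have hLK : (kGeo x.toKIdx).L = L := by rw [hLdef]; show (((θ.ℓ₆ + 1 : ℕ) : ℝ)) = _; push_cast; ring
  have hLK9 : (geo9K x.toKIdx).L = L := hLK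
  have hMK' : (kGeo x.toKIdx).M = (geo9Y x).M := rfl
  have hMK9 : (geo9K x.toKIdx).M = (geo9Y x).M := rfl
  have hMα : 0 ≤ (geo9Y x).M * α₀ := mul_nonneg (geo9Y_M_nonneg θ Mstar x) hα.le
  have ha3 : (geo9Y x).M * α₀ ≤ 1 / (10 * L) := ha.trans ((min_le_right _ _).trans (min_le_left _ _))
  have ha4 : (geo9Y x).M * α₀ ≤ 1 / (40 * Real.exp 4 * L ^ 3) :=
    ha.trans ((min_le_right _ _).trans ((min_le_right _ _).trans (min_le_left _ _)))
  have ha5 : (geo9Y x).M * α₀ ≤ 1 / (2 * εc * R) :=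
    ha.trans ((min_le_right _ _).trans ((min_le_right _ _).trans (min_le_right _ _)))
  -- a section of `β` and the weight letter `ℓ(b) = ℓ(ιB(blkV1 b))`
  obtain ⟨ιB, hι⟩ : ∃ ιB : BlkY x.toKIdx → IBondY x.toKIdx, ∀ s, β x.hN x.D x.hk (ιB s) = s :=
    ⟨fun s => (hsurj s).choose, fun s => (hsurj s).choose_spec⟩
  obtain ⟨wl, hwl⟩ : ∃ wl : FBondY x.toKIdx → ℝ, ∀ b', wl b' = (geo9K x.toKIdx).len (ιB (blkV1 x.hN x.D b')) := ⟨_, fun _ => rfl⟩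
  have hwl0 : ∀ b', 0 < wl b' := fun b' => by rw [hwl]; exact geo9K_len_pos x.toKIdx _
  have hwl1 : ∀ b', wl b' ≠ 0 := fun b' => (hwl0 b').ne'
  -- `S⁻¹ := M_{ℓ⁻¹} G M_{ℓ⁻¹}` is a left inverse of `S := M_ℓ Δ_a M_ℓ`
  have hGΔ : ∀ Φ, GAY x.toKIdx parS (parBY x.toKIdx) Gp U
      (deltaAY x.toKIdx parS (parBY x.toKIdx) Gp U Φ) = Φ := by
    intro Φ
    rw [← Module.End.mul_apply, GAY_mul_deltaAY x.toKIdx hunit, Module.End.one_apply]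
  have hinv := sandwich_leftInv (r := wl) hwl1 hGΔ
  -- (ii) the (2.51) majorant of `conj b S⁻¹` (Thm 3.3's block read by lit-balaban's dictionary, diagonal sandwich) and its row sums
  have hmajG := hasMajorant_conj_G_of_eBlockInvB x.toKIdx (basis39 (Matrix (Fin N) (Fin N) ℂ)) (Rr := 0) (Hp := True)
    (B := bg9YP (Matrix (Fin N) (Fin N) ℂ) (specialUnitaryUnits (Fin N)) x) (U₁ := U) (fun V => V)
    (GAY x.toKIdx parS (parBY x.toKIdx) Gp) (parBY x.toKIdx) hEB hKA ιB hι hMb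
    (fun v j => abs_repr_le (basis39 (Matrix (Fin N) (Fin N) ℂ)) v j)
    ((GAY x.toKIdx parS (parBY x.toKIdx) Gp U).restrictScalars ℝ)
    (fun Λ => LinearMap.restrictScalars_apply ℝ _ Λ)
  have hmajS := hasMajorant_conj_sandwich (basis39 (Matrix (Fin N) (Fin N) ℂ)) (g := toB6 (geo9K x.toKIdx) 0 True)
    (fun b' : FBondY x.toKIdx => ιB (blkV1 x.hN x.D b')) (geo9K x.toKIdx).len (geo9K_len_pos x.toKIdx)
    (r := fun b' => (wl b')⁻¹) (fun b' => by rw [hwl, abs_of_pos (inv_pos.2 (geo9K_len_pos x.toKIdx _))]) hmajG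
  have hML : ML ≤ (geo9K x.toKIdx).M := by rw [hMK9]; exact ((le_max_left _ _).trans (le_max_right _ _)).trans hM
  have hMtr' : Mtr ≤ (geo9Y x).M := ((le_max_left _ _).trans ((le_max_right _ _).trans (le_max_right _ _))).trans hM
  have hMlog : |(1 : ℝ)| * Real.log (geo9K x.toKIdx).L ≤ δA / 2 * (2 * ((θ.ℓ₆ : ℝ) + 1) ^ 2 - 1) * (geo9K x.toKIdx).M := by
    have hden : 0 < δA / 2 * (2 * L ^ 2 - 1) := by
      have : 1 ≤ L ^ 2 := one_le_pow₀ hL1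
      have : 0 < 2 * L ^ 2 - 1 := by linarith
      positivity
    have h := (div_le_iff₀ hden).1 hMtr'
    rw [hLK9, hMK9, ← hLdef]
    linarith
  have hrowS : ∀ a, ∑ a', C₀ * (geo9K x.toKIdx).len a * ((geo9K x.toKIdx).len a')⁻¹ * Real.exp (-(δA * (geo9K x.toKIdx).dist a a')) ≤ R := by
    intro a
    refine (rowSum_weighted_le x.toKIdx hδA hC₀0 (hrowC x.toKIdx hML) hMlog a).trans ?_
    rw [hRdef, hLK9]
    exact le_max_left _ _
  -- hence every real eigenvalue `λ` of `S` has `|λ| ≥ R⁻¹`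
  have heig := inv_le_abs_eigen_of_leftInv (basis39 (Matrix (Fin N) (Fin N) ℂ)) (g := toB6 (geo9K x.toKIdx) 0 True)
    (fun p : FBondY x.toKIdx × κ39 (Matrix (Fin N) (Fin N) ℂ) => ιB (blkV1 x.hN x.D p.1)) hinv hmajS hR0 hrowS
  -- (i) the form bound: the class's plaquette window and (3.26) + (3.69) in scale-weighted form
  have hK1 : 10 * (kGeo x.toKIdx).L * ((kGeo x.toKIdx).M * α₀) ≤ 1 := by
    rw [hLK, hMK']
    have := (le_div_iff₀ (by positivity : (0 : ℝ) < 10 * L)).1 ha3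
    linarith
  obtain ⟨δh, hδh⟩ : ∃ δh : ℝ, δh = 40 * Real.exp 4 * L ^ 3 * ((geo9Y x).M * α₀) := ⟨_, rfl⟩
  have hδh0 : 0 ≤ δh := by rw [hδh]; positivity
  have hδh1 : δh ≤ 1 := by
    have := (le_div_iff₀ (by positivity : (0 : ℝ) < 40 * Real.exp 4 * L ^ 3)).1 ha4
    rw [hδh]; linarith
  have hplaq : ∀ p : PlaqY x.toKIdx, ‖((holY x.toKIdx U p : (Matrix (Fin N) (Fin N) ℂ)ˣ) : Matrix (Fin N) (Fin N) ℂ) - 1‖ ≤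
      δh * ((((θ.ℓ₆ : ℝ) + 1) ^ levV1 x.toKIdx p.src)⁻¹) ^ 2 := by
    intro p
    have h := norm_holY_sub_one_le_window_of_reg335P x.toKIdx U (by norm_num [c35Y]) (by rw [hMK']; exact hMα) hK1 hU.1 p
    rw [hLK, hMK'] at h
    rw [hδh]
    exact h
  have hform := form_sandwich_ge (ε := 12 * ((θ.d₆ : ℝ) + 1) * ((θ.ℓ₆ : ℝ) + 1) ^ 2 * δh) wl
    (fun b' : FBondY x.toKIdx => x.toKIdx.cf ^ 2 * ((((θ.ℓ₆ : ℝ) + 1) ^ levV1 x.toKIdx b'.src)⁻¹) ^ 2)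
    (fun b' => by rw [hwl]; exact len_sq_mul_weight x.toKIdx ιB hι b')
    (fun A' => (trIP_hessY_ge_neg_weighted x.toKIdx hU' hδh0 hδh1 hplaq A').trans (hΔle A'))
  -- symmetry of `S`
  have hsymm := isSymmTr_sandwich wl hsymmA
  -- (iii) the gap `ε·R < 1`
  have hεK : 12 * ((θ.d₆ : ℝ) + 1) * ((θ.ℓ₆ : ℝ) + 1) ^ 2 * δh * R < 1 := by
    have h0 : 12 * ((θ.d₆ : ℝ) + 1) * ((θ.ℓ₆ : ℝ) + 1) ^ 2 * δh = εc * ((geo9Y x).M * α₀) := by rw [hδh, hεc, hLdef]; ring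
    rw [h0]
    have h2 : εc * ((geo9Y x).M * α₀) * R ≤ εc * (1 / (2 * εc * R)) * R :=
      mul_le_mul_of_nonneg_right (mul_le_mul_of_nonneg_left ha5 hεc0.le) hR0.le
    have h3 : εc * (1 / (2 * εc * R)) * R = 1 / 2 := by field_simp
    linarith
  -- §1: `S ≥ R⁻¹` as forms; §2: un-sandwich in the weight `wl⁻² = c_f²(L^{lev})⁻²`
  have hgap := form_ge_of_isSymmTr_of_form_ge_of_eigen_abs_ge (w := fun _ => (1 : ℝ)) (fun _ => one_pos) _ hsymm hR0 hεK hform heig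
  have hA := form_ge_weighted_of_sandwich wl hwl1 hgap A
  have hwt : ∀ b' : FBondY x.toKIdx, ((wl b')⁻¹) ^ 2 = x.toKIdx.cf ^ 2 * ((((θ.ℓ₆ : ℝ) + 1) ^ levV1 x.toKIdx b'.src)⁻¹) ^ 2 := by
    intro b'
    have h1 := len_sq_mul_weight x.toKIdx ιB hι b'
    rw [← hwl] at h1
    rw [inv_pow, ← one_div, div_eq_iff (pow_ne_zero 2 (hwl1 b')), mul_comm]
    exact h1.symm
  simp only [hwt] at hA
  exact hA


/-! ## §2 ★★★ Row 17 at the knit letter, parametric site transporter -/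

/-- ★★★ **ROW 17 AT THE KNIT LETTER AT A PARAMETRIC SITE TRANSPORTER**, at section-carrying members on (3.35): with the four laws at `(parS, Gp)`
(Thm 3.3 block `IsUnit`+`EBlock (K_A, δ_A)`, `Δ_a` symmetric, `R ≥ 0`), a partner `𝔮s` adjoint to `QknitY x` at `U`, and the x-free numerics
`0 < α₀′ ≤ α_Q`, `K_pl(Mα₀)L⁴ < α₀′`, `δ(2√(2b₁)+δ) < γ` (`δ = α₀′m₀√(2Nb₁)`): `PosDefTr 1 (deltaAQY x (QknitY x) 𝔮s parS Gp U)` — at `parS := parKnitY`,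
`Gp := GpY parKnitY` this is row 17 of the «K» certificate (CASCADE-K). [cite: Balaban1985BackgroundPropagators, Thm 3.11 p.416; Thm 3.3 p.399; (3.26) p.395; (3.12)–(3.13) p.392, (3.14)–(3.15) p.393; (3.115) p.419; (3.35) p.396; Balaban1985Averaging, (139)–(147) pp.39–40] -/
theorem posDefTr_deltaAQY_QknitY_of_laws {δA KA : ℝ} (hδA : 0 < δA) (hKA : 0 ≤ KA) :
    ∃ M₁ a₁ γ : ℝ, 0 < M₁ ∧ 0 < a₁ ∧ 0 < γ ∧
    ∀ (x : MemberY θ.d₆ θ.ℓ₆ θ.hd' θ.hL' θ.b₀ θ.b₁ Mstar), Function.Surjective (β x.hN x.D x.hk) → M₁ ≤ (geo9Y x).M →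
      ∀ α₀ : ℝ, 0 < α₀ → (geo9Y x).M * α₀ ≤ a₁ →
      ∀ U : CfgY (Matrix (Fin N) (Fin N) ℂ) x.toKIdx,
        (bg9YP (Matrix (Fin N) (Fin N) ℂ) (specialUnitaryUnits (Fin N)) x).Reg335 c35Y α₀ U →
        ∀ (parS : SiteParY (Matrix (Fin N) (Fin N) ℂ) x.toKIdx) (Gp : SiteOpY (Matrix (Fin N) (Fin N) ℂ) x.toKIdx),
          IsUnit (deltaAY x.toKIdx parS (parBY x.toKIdx) Gp U) →
          EBlock (kernelFamilyBInv x.toKIdx (bg9YP (Matrix (Fin N) (Fin N) ℂ) (specialUnitaryUnits (Fin N)) x) (fun V => V)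
            (GAY x.toKIdx parS (parBY x.toKIdx) Gp) (parBY x.toKIdx)) KA δA U →
          IsSymmTr (fun _ => (1 : ℝ)) (deltaAY x.toKIdx parS (parBY x.toKIdx) Gp U) →
          (∀ f, 0 ≤ trIP (fun _ => (1 : ℝ)) f (RY x.toKIdx parS Gp U f)) →
        ∀ (𝔮s : CfgY (Matrix (Fin N) (Fin N) ℂ) x.toKIdx →
              ((IBondY x.toKIdx → Matrix (Fin N) (Fin N) ℂ) →ₗ[ℂ] (FBondY x.toKIdx → Matrix (Fin N) (Fin N) ℂ))),
          IsAdjTr (fun _ => (1 : ℝ)) (fun _ => (1 : ℝ)) (QknitY x.toKIdx U) (𝔮s U) →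
        ∀ α₀' : ℝ, 0 < α₀' → α₀' ≤ alphaQ (θ.d₆ + 1) (θ.ℓ₆ + 1) →
          Kpl x.toKIdx ((geo9Y x).M * α₀) * (((θ.ℓ₆ : ℝ) + 1)) ^ 4 < α₀' →
          (α₀' * (2 * ((θ.d₆ : ℝ) + 1) * kCol (θ.d₆ + 1) (θ.ℓ₆ + 1) + 8 * ((θ.d₆ : ℝ) + 2) ^ 2) * Real.sqrt (2 * (N : ℝ) * θ.b₁))
              * (2 * Real.sqrt (2 * θ.b₁)
                + α₀' * (2 * ((θ.d₆ : ℝ) + 1) * kCol (θ.d₆ + 1) (θ.ℓ₆ + 1) + 8 * ((θ.d₆ : ℝ) + 2) ^ 2) * Real.sqrt (2 * (N : ℝ) * θ.b₁)) < γ →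
          PosDefTr (fun _ => (1 : ℝ))
            (deltaAQY x.toKIdx (QknitY x.toKIdx) 𝔮s parS Gp U) := by
  have hN : 1 ≤ N := Fin.pos_iff_nonempty.2 inferInstance
  obtain ⟨M₁, a₁, γ, hM₁, ha₁, hγ, h⟩ := formGap_deltaAY_of_laws (N := N) θ Mstar hN hδA hKA
  refine ⟨M₁, a₁, γ, hM₁, ha₁, hγ, fun x hsurj hM α₀ hα ha U hU parS Gp hunit hE hsymmA hRpsd 𝔮s hQ α₀' hα' hαQ hK hβ => ?_⟩
  have hGU : specialUnitaryUnits (Fin N) ≤ B7Prop2Explicit.unitaryUnits (Matrix (Fin N) (Fin N) ℂ) := specialUnitaryUnits_le_unitaryUnits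
  have hb₁ : 0 ≤ θ.b₁ := le_trans θ.hb.1.le θ.hb.2
  have hreg : (bg9KP (Matrix (Fin N) (Fin N) ℂ) (specialUnitaryUnits (Fin N)) x.toKIdx).Reg335 c35Y α₀ U := hU.1
  have hMα : 0 ≤ (kGeo x.toKIdx).M * α₀ := mul_nonneg (B9Thm39OneCubeReadingAtLettersY.geo9Y_M_nonneg θ Mstar x) hα.le
  have hLK : (kGeo x.toKIdx).L = (θ.ℓ₆ : ℝ) + 1 := by show (((θ.ℓ₆ + 1 : ℕ) : ℝ)) = _; push_cast; ring
  have hK' : Kpl x.toKIdx ((kGeo x.toKIdx).M * α₀) * (kGeo x.toKIdx).L ^ 4 < α₀' := by rw [hLK]; exact hK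
  -- the row transports of dag-n06-l, kept opaque
  obtain ⟨T, hT⟩ : ∃ T : IBondY x.toKIdx → (Matrix (Fin N) (Fin N) ℂ)ˣ, ∀ ι, T ι =
      (parTaxiV U (B15DeterminingSets.embIter (ι.1.1 : ℕ) ι.1.2.src)
        (B10Eq27TorusAxialLog.transl (0 : Site (PV θ.d₆ θ.ℓ₆ x.toKIdx.m x.toKIdx.K θ.hd' θ.hL') 0)
          (B7Prop1Local.loK (θ.ℓ₆ + 1) (ι.1.1 : ℕ) (zSrc x.toKIdx ι))))⁻¹ := ⟨_, fun _ => rfl⟩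
  have hTc : ∀ ι, ‖(T ι : Matrix (Fin N) (Fin N) ℂ)‖ ≤ 1 ∧ ‖(((T ι)⁻¹ : (Matrix (Fin N) (Fin N) ℂ)ˣ) : Matrix (Fin N) (Fin N) ℂ)‖ ≤ 1 := by
    intro ι
    rw [hT ι]
    exact B9Ineq349SiteFromConv342.contractive_of_mem hGU (rebase_mem x.toKIdx hU.1.1 ι)
  have hm₀0 : 0 ≤ 2 * ((θ.d₆ : ℝ) + 1) * kCol (θ.d₆ + 1) (θ.ℓ₆ + 1) + 8 * ((θ.d₆ : ℝ) + 2) ^ 2 := by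
    have := kCol_nonneg (θ.d₆ + 1) (θ.ℓ₆ + 1); positivity
  have hδ0 : 0 ≤ α₀' * (2 * ((θ.d₆ : ℝ) + 1) * kCol (θ.d₆ + 1) (θ.ℓ₆ + 1) + 8 * ((θ.d₆ : ℝ) + 2) ^ 2) * Real.sqrt (2 * (N : ℝ) * θ.b₁) := by
    positivity
  have hwgt : ∀ b : FBondY x.toKIdx, 0 < x.toKIdx.cf ^ 2 * ((((θ.ℓ₆ : ℝ) + 1) ^ levV1 x.toKIdx b.src)⁻¹) ^ 2 := by
    intro b
    have hcf : x.toKIdx.cf ≠ 0 := x.toKIdx.hcf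
    have hL : (0 : ℝ) < ((θ.ℓ₆ : ℝ) + 1) ^ levV1 x.toKIdx b.src := pow_pos (by positivity) _
    positivity
  have hwsum : ∀ A : FBondY x.toKIdx → Matrix (Fin N) (Fin N) ℂ,
      trIP (fun b => x.toKIdx.cf ^ 2 * ((((θ.ℓ₆ : ℝ) + 1) ^ levV1 x.toKIdx b.src)⁻¹) ^ 2) A A
        = ∑ b, (x.toKIdx.cf ^ 2 * ((((θ.ℓ₆ : ℝ) + 1) ^ levV1 x.toKIdx b.src)⁻¹) ^ 2) * ∑ a, ∑ c, ‖A b a c‖ ^ 2 :=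
    fun A => trIP_self_eq_sum _ A
  refine posDefTr_deltaAQY_of_formGap_of_close_rebased x.toKIdx hGU parS Gp (fun s s' => parBY_mem x.toKIdx hU.1.1 s s') hQ
    (fun A => trIP_w_eq_of_rowRebase x.toKIdx (parBY x.toKIdx) U
      (trLiftY (1 : Matrix (IBondY x.toKIdx) (IBondY x.toKIdx) ℝ) (fun ι' _ => T ι') ∘ₗ QY x.toKIdx (parBY x.toKIdx) U) T hTc
      (fun A ι => rebaseRef_apply x.toKIdx T (parBY x.toKIdx) U A ι) A)
    hwgt (Real.sqrt_nonneg _) hδ0 (fun A => ?_) (fun A => ?_) (fun A => ?_) hβ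
  · rw [hwsum]; exact h x hsurj hM α₀ hα ha U hU parS Gp hunit hE hsymmA hRpsd A
  · rw [hwsum]; exact trIP_w_QY_parBY_le_member θ Mstar x hU.1.1 A
  -- the closeness in the `trIP` currency
  rw [hwsum]
  have hclose := trIP_w_QknitY_sub_rebase_le x.toKIdx hGU hb₁ (show c35Y ≤ 10 by norm_num [c35Y]) hMα hreg hα' hαQ hK' T hT A
  have hfun : (QknitY x.toKIdx U - trLiftY (1 : Matrix (IBondY x.toKIdx) (IBondY x.toKIdx) ℝ) (fun ι' _ => T ι') ∘ₗ QY x.toKIdx (parBY x.toKIdx) U) A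
      = fun ι => QknitY x.toKIdx U A ι - B9Eq39Adjoint.R (T ι) (QY x.toKIdx (parBY x.toKIdx) U A ι) := by
    funext ι
    rw [LinearMap.sub_apply, Pi.sub_apply, rebaseRef_apply]
  have hδsq : (α₀' * (2 * ((θ.d₆ : ℝ) + 1) * kCol (θ.d₆ + 1) (θ.ℓ₆ + 1) + 8 * ((θ.d₆ : ℝ) + 2) ^ 2) * Real.sqrt (2 * (N : ℝ) * θ.b₁)) ^ 2
      = (α₀' * (2 * ((θ.d₆ : ℝ) + 1) * kCol (θ.d₆ + 1) (θ.ℓ₆ + 1) + 8 * ((θ.d₆ : ℝ) + 2) ^ 2)) ^ 2 * (2 * (N : ℝ) * θ.b₁) := by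
    rw [mul_pow, Real.sq_sqrt (by positivity)]
  rw [hfun, hδsq]
  exact hclose


end Record

end Literature.MathematicalPhysics.QuantumFieldTheory.Balaban1983to89.B9Thm311FormGapOfLawsAtLettersY

end
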